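import Literature.NumberTheory.LFunctions.PrimitiveQuadraticCharacterGaussSum
import Literature.NumberTheory.LFunctions.DirichletLogDerivDisc
import Mathlib.Analysis.SpecialFunctions.Gamma.Digamma
import HarnessLib

/-!
# Hiary–Ireland–Kyi: Riemann's method for verifying the (generalised) Riemann hypothesis at low height,
# for real primitive Dirichlet characters (Math. Comp. 2026)

Topic `Literature/NumberTheory/LFunctions`; namespace `Literature.NumberTheory.LFunctions`, grouping namespace
`HiaryIrelandKyi2026` for the printed auxiliary quantities.  Typed for the parity-realchar cell («instrument
provenance»: certified zero computations for real characters `χ_d`; recent-theorem harvest next to Booker 2006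
/ Platt 2016, which the paper follows).  Statement-first (D-0064): the two printed results are NAMED FACTS
(D-0014), stated over the tree's `DirichletTheta.dirichletXi` (MV's `ξ(s, χ)`), `DirichletDisc.zeroOrder`
(multiplicity of a zero of `L(s, χ)`) and Mathlib's `Complex.digamma`; the elementary identities between the
printed constants are PROVED.

## Source, as printed

G. Hiary, S. Ireland, M. Kyi, *A method for verifying the generalized Riemann hypothesis*, Math. Comp. (2026; published electronically 2025),
doi:10.1090/mcom/4129 = arXiv:2408.00187 [HiaryIrelandKyi2026].

§4 (the class): «`L(s) = Σ a(n)n^{−s}` absolutely convergent in `σ > 1` … the Dirichlet coefficients `a(n)` are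
real … Euler product of degree `r` … `|α_{p,j}| ≤ 1` … `ξ_L(s) := γ(s)L(s)`, `γ(s) := ε N^{s/2} π^{−sr/2}
Π Γ(s/2 + μ_j/2)` extends to an entire function and satisfies `ξ_L(s) = conj ξ_L(1 − s̄)` … We assume
`L(1) ≠ 0` … the zeros of `ξ_L(s)` are exactly the nontrivial zeros of `L(s)`.»  §3, (phi def):
`φ(β, η, x) := (β − x)/((β − x)² + η²) + (1 − β − x)/((1 − β − x)² + η²)`.  Lemma 4 / **Corollary 5**:
`w_{1,δ} := Σ_ρ 1/(ρ − δ)` (paired) `= ½ log N − (r/2) log π + ½ Σ_j ψ₀((1 − δ + μ_j)/2) + L′(1−δ)/L(1−δ)`.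

**Theorem 7.** «Let `δ` be a real nonpositive number and let `τ` be a real positive number.  Let `𝒵` be a
set of nonempty disjoint subintervals of the form `[γ₋, γ₊] ⊆ [0, τ]` or of the form `[−γ₀, γ₀] ⊆ [−τ, τ]`.
Suppose that `ξ_L(1/2 + it)` has a sign change in each subinterval in `𝒵` [i.e. `ξ_L(1/2 + iτ₁) < 0 <
ξ_L(1/2 + iτ₂)` for some `τ₁, τ₂` in each subinterval].  Define `C(𝒵, δ) := Σ_{[γ₋,γ₊]∈𝒵} (1−2δ)/((1/2−δ)² +
γ₊²) + Σ_{[−γ₀,γ₀]∈𝒵} (1/2−δ)/((1/2−δ)² + γ₀²)` … `f₁(η, δ, m) := 2m·min(φ(0, η, δ), φ(1/2, η, δ))`, …,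
`h₁(δ, m) := m·φ(1/2, 0, δ)`, `h₂(δ, m) := m/2·φ(1/2, 0, δ)` … zeros are counted with multiplicity in all
cases.  (i) If `f₁(η, δ, m) + C(𝒵, δ) > w_{1,δ}`, then there are strictly fewer than `4m` non-real `ρ`'s off the
critical line of height `≤ η`. … (iii) If `h₁(δ, m) + C(𝒵, δ) > w_{1,δ}`, then there are strictly fewer than
`2m` real `ρ`'s off the critical line.  (iv) If `h₂(δ, m) + C(𝒵, δ) > w_{1,δ}`, then a zero at the central point
`s = 1/2` has multiplicity strictly less than `m`.»

**Corollary 1** (§1; Theorem 7 (i) with `δ = −1`, `m = 1` and Corollary 5).  «Let `d` be a positive fundamental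
discriminant, `τ` be a real positive number, and `𝒵` be a set of nonempty disjoint subintervals of the form
`[γ₋, γ₊] ⊆ [0, τ]` or of the form `[−γ₀, γ₀] ⊆ [−τ, τ]`.  Suppose that `L(1/2 + it, χ_d)` has a zero of odd
multiplicity in each subinterval in `𝒵`.  Further, define `C(𝒵) := Σ_{[γ₋,γ₊]∈𝒵} 12/(9 + 4γ₊²) +
Σ_{[−γ₀,γ₀]∈𝒵} 6/(9 + 4γ₀²)`.  Let `λ₀ = 0.57721566…` be the Euler constant.  For any real positive number `η`,
if `2ι(η) + C(𝒵) > ½ log(d/(π e^{λ₀})) + (L′/L)(2, χ_d)`, then RH holds for all the nontrivial zeros of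
`L(s, χ_d)` with positive height `≤ η`», `ι(η) := min(1/(1+η²) + 2/(4+η²), 12/(9+4η²))`.
[cite: HiaryIrelandKyi2026, §1 Corollary 1; §3 (phi def); §4 Lemma 4, Corollary 5, Theorem 7]

Numbering: that of arXiv:2408.00187 (checked on the TeX source: one shared counter, `\newtheorem{theorem}`
without section prefix — Corollary 1 (`corollary dirichlet`), Corollary 2 (zeta), Lemma 3 (`φ`), Lemma 4,
Corollary 5 (`k = 1`), Lemma 6, Theorem 7 (`main theorem l`), …, Proposition 12); the journal pagination /
numbering was not available as text here.

## What is typed (special case recorded)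

The instance `L = L(s, χ)`, `χ` a PRIMITIVE QUADRATIC (real) Dirichlet character mod `q > 1` — in §4's
notation `r = 1`, `N = q`, `μ₁ = κ` (parity), real coefficients, `ε = 1` (MV Thm 9.17, tree:
`PrimitiveQuadratic.rootNumber_eq_one_of_isQuadratic`), `L(1, χ) ≠ 0` (Dirichlet); HIK's `ξ_L(½ + it)` is the
positive constant `(π/q)^{κ/2}` times the tree's `ξ(½ + it, χ)` (`DirichletTheta.dirichletXi`, MV (10.19)),
which is REAL there (`dirichletXi_criticalLine_im_eq_zero_of_isQuadratic`), so «sign change» is read on its real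
part.  Only subintervals of the first kind `[γ₋, γ₊] ⊆ [0, τ]` are typed (a set `𝒵` without symmetric members
is a special case of the printed hypothesis — TODO(general form): the symmetric subintervals `[−γ₀, γ₀]`, the
general class of §4, general `m`).  Facts:
* `hiaryIrelandKyi2026_corollary1` — Corollary 1 verbatim (even `χ`, `d = q > 0`; odd-multiplicity zeros via
  `DirichletDisc.zeroOrder`);
* `hiaryIrelandKyi2026_theorem7` — Theorem 7 (i), (iii), (iv) at `m = 1`, general `δ ≤ 0`, for primitive
  quadratic `χ` of either parity, with `w_{1,δ}` in the closed form of Corollary 5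
  (`HiaryIrelandKyi2026.wOne`; `ψ₀` = Mathlib's `Complex.digamma`); the printed conclusions «fewer than `4`
  non-real zeros off the line of height `≤ η`» / «fewer than `2` real zeros off the line» / «multiplicity at `½`
  less than `1`» are read, through the symmetries `ρ ↦ 1 − ρ`, `ρ ↦ ρ̄` of the zeros of a real primitive `χ`,
  as: no zero `ρ` with `0 < |Im ρ| ≤ η` off the line / no real zero `β ∈ (0, 1)`, `β ≠ ½` / `L(½, χ) ≠ 0`.
PROVED: `phi_half_zero_neg_one` (`h₁(−1, 1) = 4/3`), `two_mul_iota_eq` (`f₁(η, −1, 1) = 2ι(η)`),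
`C_neg_one` (`C(𝒵, −1) = Σ 12/(9 + 4γ₊²)`), `wOne_neg_one_of_even` (`w_{1,−1} = ½ log(q/(πe^{λ₀})) +
(L′/L)(2, χ)` for even `χ`, `ψ₀(1) = −λ₀`) — the bookkeeping from Theorem 7 to Corollary 1 — and
`hiaryIrelandKyi2026_corollary1.noOffLineZero` (projection).

`lean search` (2026-08-27): no decl mentions the paper or arXiv:2408.00187.

## References

* [HiaryIrelandKyi2026] G. Hiary, S. Ireland, M. Kyi, *A method for verifying the generalized Riemann
  hypothesis*, Math. Comp. (2026; published electronically 2025), doi:10.1090/mcom/4129, arXiv:2408.00187 (held: `paper:arxiv-2408.00187`).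
* [Booker2006] A. R. Booker, Experiment. Math. 15 (2006) 385–407 (the class of `L`-functions, §4).
* [MontgomeryVaughan2007] H. L. Montgomery, R. C. Vaughan, *Multiplicative Number Theory I*, (10.19), Thm 9.17.
-/

noncomputable section

open Complex Finset

namespace Literature.NumberTheory.LFunctions

open DirichletTheta DirichletDisc

namespace HiaryIrelandKyi2026

/-- `φ(β, η, x) := (β − x)/((β − x)² + η²) + (1 − β − x)/((1 − β − x)² + η²)` — the contribution
`Re[1/(ρ − x) + 1/(1 − ρ − x)]` of a zero `ρ = β + iη` and its partner `1 − ρ` to `w_{1,x}`.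
[cite: HiaryIrelandKyi2026, §3 (phi def)] -/
def phi (β η x : ℝ) : ℝ :=
  (β - x) / ((β - x) ^ 2 + η ^ 2) + (1 - β - x) / ((1 - β - x) ^ 2 + η ^ 2)

/-- `ι(η) := min(1/(1 + η²) + 2/(4 + η²), 12/(9 + 4η²))` — the minimal contribution of a hypothetical
counter-example of positive height `≤ η` (`= ½ f₁(η, −1, 1)`, see `two_mul_iota_eq`).
[cite: HiaryIrelandKyi2026, §1 (definition of ι)] -/
def iota (η : ℝ) : ℝ :=
  min (1 / (1 + η ^ 2) + 2 / (4 + η ^ 2)) (12 / (9 + 4 * η ^ 2))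

/-- `C(𝒵, δ) := Σ_{[γ₋,γ₊]∈𝒵} (1 − 2δ)/((1/2 − δ)² + γ₊²)` — the minimal contribution of the known zeros
(intervals of the first kind only; an interval is the pair `(γ₋, γ₊)` of its endpoints).
[cite: HiaryIrelandKyi2026, §4 Theorem 7 (definition of C(𝒵, δ))] -/
def C (Z : Finset (ℝ × ℝ)) (δ : ℝ) : ℝ :=
  ∑ P ∈ Z, (1 - 2 * δ) / ((1 / 2 - δ) ^ 2 + P.2 ^ 2)

variable {q : ℕ} [NeZero q]

/-- `w_{1,δ}` of `L(s, χ)` in the closed form of Corollary 5 (`r = 1`, `N = q`, `μ₁ = κ` the parity of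
`χ`): `w_{1,δ} = ½ log q − ½ log π + ½ ψ₀((1 − δ + κ)/2) + (L′/L)(1 − δ, χ)` (real part taken; every term is
real for a real character and real `δ < 1`).  By Lemma 4 this is `Σ_ρ 1/(ρ − δ)` over the nontrivial zeros,
paired. [cite: HiaryIrelandKyi2026, §4 Lemma 4, Corollary 5] -/
def wOne (χ : DirichletCharacter ℂ q) (δ : ℝ) : ℝ :=
  1 / 2 * Real.log q - 1 / 2 * Real.log Real.pi +
    1 / 2 * (Complex.digamma (((1 - δ + (charParity χ : ℝ)) / 2 : ℝ) : ℂ)).re +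
    (deriv χ.LFunction ((1 - δ : ℝ) : ℂ) / χ.LFunction ((1 - δ : ℝ) : ℂ)).re

/-- **Admissible zero data of Theorem 7** (intervals of the first kind): `𝒵` is a finite set of subintervals
`[γ₋, γ₊] ⊆ [0, τ]`, pairwise disjoint, and `ξ(½ + it, χ)` changes sign in each: «`ξ_L(1/2 + iτ₁) < 0 <
ξ_L(1/2 + iτ₂)` for some `τ₁, τ₂` in each subinterval» (`ξ` = the tree's `dirichletXi`, real on the critical
line for real primitive `χ`). [cite: HiaryIrelandKyi2026, §4 Theorem 7 (hypotheses)] -/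
def IsSignChangeData (χ : DirichletCharacter ℂ q) (τ : ℝ) (Z : Finset (ℝ × ℝ)) : Prop :=
  (∀ P ∈ Z, 0 ≤ P.1 ∧ P.1 ≤ P.2 ∧ P.2 ≤ τ) ∧
  (∀ P ∈ Z, ∀ Q ∈ Z, P ≠ Q → Disjoint (Set.Icc P.1 P.2) (Set.Icc Q.1 Q.2)) ∧
  (∀ P ∈ Z, ∃ τ₁ ∈ Set.Icc P.1 P.2, ∃ τ₂ ∈ Set.Icc P.1 P.2,
    (dirichletXi χ (1 / 2 + τ₁ * I)).re < 0 ∧ 0 < (dirichletXi χ (1 / 2 + τ₂ * I)).re)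

/-- **Admissible zero data of Corollary 1**: subintervals `[γ₋, γ₊] ⊆ [0, τ]`, pairwise disjoint, and
«`L(1/2 + it, χ_d)` has a zero of odd multiplicity in each subinterval» (multiplicity = the tree's
`DirichletDisc.zeroOrder`, Mathlib's `analyticOrderNatAt` of `L(·, χ)`).
[cite: HiaryIrelandKyi2026, §1 Corollary 1 (hypotheses)] -/
def IsOddZeroData (χ : DirichletCharacter ℂ q) (τ : ℝ) (Z : Finset (ℝ × ℝ)) : Prop :=
  (∀ P ∈ Z, 0 ≤ P.1 ∧ P.1 ≤ P.2 ∧ P.2 ≤ τ) ∧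
  (∀ P ∈ Z, ∀ Q ∈ Z, P ≠ Q → Disjoint (Set.Icc P.1 P.2) (Set.Icc Q.1 Q.2)) ∧
  (∀ P ∈ Z, ∃ t ∈ Set.Icc P.1 P.2,
    χ.LFunction (1 / 2 + t * I) = 0 ∧ Odd (zeroOrder χ (1 / 2 + t * I)))

/-! #### The printed constants at `δ = −1`, `m = 1` (PROVED bookkeeping) -/

/-- `h₁(−1, 1) = φ(½, 0, −1) = 4/3`. [cite: HiaryIrelandKyi2026, §4 Theorem 7 (definition of h₁)] -/
theorem phi_half_zero_neg_one : phi (1 / 2) 0 (-1) = 4 / 3 := by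
  norm_num [phi]

/-- `h₂(−1, 1) = ½ φ(½, 0, −1) = 2/3`. [cite: HiaryIrelandKyi2026, §4 Theorem 7 (definition of h₂)] -/
theorem half_phi_half_zero_neg_one : 1 / 2 * phi (1 / 2) 0 (-1) = 2 / 3 := by
  norm_num [phi]

/-- `f₁(η, −1, 1) = 2 min(φ(0, η, −1), φ(½, η, −1)) = 2ι(η)`.
[cite: HiaryIrelandKyi2026, §1 (Corollary 1 from Theorem 7 (i))] -/
theorem two_mul_iota_eq (η : ℝ) : 2 * min (phi 0 η (-1)) (phi (1 / 2) η (-1)) = 2 * iota η := by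
  have h1 : phi 0 η (-1) = 1 / (1 + η ^ 2) + 2 / (4 + η ^ 2) := by
    norm_num [phi]
  have h2 : phi (1 / 2) η (-1) = 12 / (9 + 4 * η ^ 2) := by
    have h9 : (9 : ℝ) / 4 + η ^ 2 ≠ 0 := by positivity
    have h9' : (9 : ℝ) + 4 * η ^ 2 ≠ 0 := by positivity
    simp only [phi]
    norm_num
    field_simp
    ring
  rw [h1, h2, iota]

/-- `C(𝒵, −1) = Σ_{[γ₋,γ₊]∈𝒵} 12/(9 + 4γ₊²)` (Corollary 1's `C(𝒵)`, intervals of the first kind).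
[cite: HiaryIrelandKyi2026, §1 Corollary 1 (definition of C(𝒵))] -/
theorem C_neg_one (Z : Finset (ℝ × ℝ)) : C Z (-1) = ∑ P ∈ Z, 12 / (9 + 4 * P.2 ^ 2) := by
  unfold C
  refine Finset.sum_congr rfl fun P _ => ?_
  have h9 : (9 : ℝ) / 4 + P.2 ^ 2 ≠ 0 := by positivity
  have h9' : (9 : ℝ) + 4 * P.2 ^ 2 ≠ 0 := by positivity
  norm_num
  field_simp
  ring

/-- For an EVEN character, `w_{1,−1} = ½ log(q/(π e^{λ₀})) + (L′/L)(2, χ)` (`ψ₀(1) = −λ₀`, Mathlib's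
`Complex.digamma_one`) — the right-hand side of Corollary 1.
[cite: HiaryIrelandKyi2026, §1 Corollary 1 / §4 Corollary 5] -/
theorem wOne_neg_one_of_even {χ : DirichletCharacter ℂ q} (heven : χ.Even) :
    wOne χ (-1) = 1 / 2 * Real.log (q / (Real.pi * Real.exp Real.eulerMascheroniConstant)) +
      (deriv χ.LFunction 2 / χ.LFunction 2).re := by
  have hq : (0 : ℝ) < q := by exact_mod_cast NeZero.pos q
  have h2 : (((1 - (-1 : ℝ)) : ℝ) : ℂ) = 2 := by norm_num
  have hψ : (Complex.digamma (((1 - (-1 : ℝ) + ((charParity χ : ℕ) : ℝ)) / 2 : ℝ) : ℂ)).re =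
      -Real.eulerMascheroniConstant := by
    rw [charParity_of_even heven, Nat.cast_zero, add_zero, show ((1 - (-1 : ℝ)) / 2 : ℝ) = 1 by norm_num,
      Complex.ofReal_one, Complex.digamma_one]
    simp
  rw [wOne, hψ, h2, Real.log_div hq.ne' (by positivity), Real.log_mul Real.pi_pos.ne' (Real.exp_pos _).ne',
    Real.log_exp]
  ring

end HiaryIrelandKyi2026

open HiaryIrelandKyi2026

/-- **Hiary–Ireland–Kyi (Math. Comp. 2026), Corollary 1 (as printed, §1):** «Let `d` be a positive fundamental
discriminant, `τ` be a real positive number, and `𝒵` be a set of nonempty disjoint subintervals of the form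
`[γ₋, γ₊] ⊆ [0, τ]` [or `[−γ₀, γ₀] ⊆ [−τ, τ]` — not typed].  Suppose that `L(1/2 + it, χ_d)` has a zero of odd
multiplicity in each subinterval in `𝒵`.  Further, define `C(𝒵) := Σ_{[γ₋,γ₊]∈𝒵} 12/(9 + 4γ₊²)` [+ …].  Let
`λ₀ = 0.57721566…` be the Euler constant.  For any real positive number `η`, if
`2ι(η) + C(𝒵) > ½ log(d/(π e^{λ₀})) + (L′/L)(2, χ_d)`, then then RH holds for all the nontrivial zeros of
`L(s, χ_d)` with positive height `≤ η`.»  Typed for the even primitive quadratic character `χ` mod `q = d`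
(`χ_d`, MV Thm 9.13), nontrivial zeros = zeros with `0 < Re < 1` (HIK §4), conclusion `Re ρ = ½` for those with
`0 < Im ρ ≤ η`.  Special case (no symmetric subintervals) of the printed statement; not discharged here.
[cite: HiaryIrelandKyi2026, §1 Corollary 1] -/
def hiaryIrelandKyi2026_corollary1 : Prop :=
  ∀ (q : ℕ) [NeZero q] (χ : DirichletCharacter ℂ q), χ.IsPrimitive → χ.IsQuadratic → χ.Even → χ ≠ 1 →
    ∀ τ : ℝ, 0 < τ → ∀ Z : Finset (ℝ × ℝ), IsOddZeroData χ τ Z →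
      ∀ η : ℝ, 0 < η →
        1 / 2 * Real.log (q / (Real.pi * Real.exp Real.eulerMascheroniConstant)) +
            (deriv χ.LFunction 2 / χ.LFunction 2).re <
          2 * iota η + ∑ P ∈ Z, 12 / (9 + 4 * P.2 ^ 2) →
        ∀ ρ : ℂ, χ.LFunction ρ = 0 → 0 < ρ.re → ρ.re < 1 → 0 < ρ.im → ρ.im ≤ η → ρ.re = 1 / 2

/-- **Hiary–Ireland–Kyi (Math. Comp. 2026), Theorem 7 (i), (iii), (iv) with `m = 1`, for `L(s, χ)`, `χ` primitive
quadratic mod `q` (§4: `r = 1`, `N = q`, `μ₁ = κ`, `ε = 1`), `w_{1,δ}` in the closed form of Corollary 5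
(`HiaryIrelandKyi2026.wOne`):** for real `δ ≤ 0`, `τ > 0`, admissible sign-change data `𝒵` (intervals
`[γ₋, γ₊] ⊆ [0, τ]`, pairwise disjoint, `ξ(½ + it, χ)` changing sign in each) and `η > 0`:
(i) «if `f₁(η, δ, 1) + C(𝒵, δ) > w_{1,δ}`, then there are strictly fewer than `4` non-real `ρ`'s off the
critical line of height `≤ η`» — read: every zero `ρ` with `0 < Re ρ < 1`, `0 < |Im ρ| ≤ η` has `Re ρ = ½` (the
off-line non-real zeros of a real `χ` come in fours `ρ, 1−ρ, ρ̄, 1−ρ̄` of equal height);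
(iii) «if `h₁(δ, 1) + C(𝒵, δ) > w_{1,δ}`, then there are strictly fewer than `2` real `ρ`'s off the critical
line» — read: no real zero `β ∈ (0, 1)`, `β ≠ ½` (they come in pairs `β, 1 − β`);
(iv) «if `h₂(δ, 1) + C(𝒵, δ) > w_{1,δ}`, then a zero at the central point `s = 1/2` has multiplicity strictly
less than `1`» — read: `L(½, χ) ≠ 0`.
Here `f₁(η, δ, 1) = 2 min(φ(0, η, δ), φ(½, η, δ))`, `h₁(δ, 1) = φ(½, 0, δ)`, `h₂(δ, 1) = ½ φ(½, 0, δ)`.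
Special case of the printed theorem (general class 𝓛, general `m`, symmetric subintervals not typed); not
discharged here. [cite: HiaryIrelandKyi2026, §4 Theorem 7 (i), (iii), (iv) with Corollary 5] -/
def hiaryIrelandKyi2026_theorem7 : Prop :=
  ∀ (q : ℕ) [NeZero q] (χ : DirichletCharacter ℂ q), χ.IsPrimitive → χ.IsQuadratic → χ ≠ 1 →
    ∀ δ : ℝ, δ ≤ 0 → ∀ τ : ℝ, 0 < τ → ∀ Z : Finset (ℝ × ℝ), IsSignChangeData χ τ Z →
      (∀ η : ℝ, 0 < η → wOne χ δ < 2 * min (phi 0 η δ) (phi (1 / 2) η δ) + C Z δ →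
          ∀ ρ : ℂ, χ.LFunction ρ = 0 → 0 < ρ.re → ρ.re < 1 → ρ.im ≠ 0 → |ρ.im| ≤ η → ρ.re = 1 / 2) ∧
      (wOne χ δ < phi (1 / 2) 0 δ + C Z δ →
          ∀ β : ℝ, 0 < β → β < 1 → β ≠ 1 / 2 → χ.LFunction β ≠ 0) ∧
      (wOne χ δ < 1 / 2 * phi (1 / 2) 0 δ + C Z δ → χ.LFunction (1 / 2) ≠ 0)

/-- Projection of Corollary 1: under its inequality, no zero of `L(s, χ_d)` with `0 < Re ρ < 1`,
`0 < Im ρ ≤ η` lies off the critical line. [cite: HiaryIrelandKyi2026, §1 Corollary 1] -/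
theorem hiaryIrelandKyi2026_corollary1.noOffLineZero (h : hiaryIrelandKyi2026_corollary1) {q : ℕ} [NeZero q]
    {χ : DirichletCharacter ℂ q} (hprim : χ.IsPrimitive) (hquad : χ.IsQuadratic) (heven : χ.Even)
    (h1 : χ ≠ 1) {τ : ℝ} (hτ : 0 < τ) {Z : Finset (ℝ × ℝ)} (hZ : IsOddZeroData χ τ Z) {η : ℝ} (hη : 0 < η)
    (hineq : 1 / 2 * Real.log (q / (Real.pi * Real.exp Real.eulerMascheroniConstant)) +
        (deriv χ.LFunction 2 / χ.LFunction 2).re < 2 * iota η + ∑ P ∈ Z, 12 / (9 + 4 * P.2 ^ 2))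
    {ρ : ℂ} (hρ : χ.LFunction ρ = 0) (hre0 : 0 < ρ.re) (hre1 : ρ.re < 1) (him0 : 0 < ρ.im) (himη : ρ.im ≤ η) :
    ρ.re = 1 / 2 :=
  h q χ hprim hquad heven h1 τ hτ Z hZ η hη hineq ρ hρ hre0 hre1 him0 himη

/-- **The Theorem-7-to-Corollary-1 bookkeeping, PROVED:** at `δ = −1` the three quantities of Theorem 7 (i)
specialise to those of Corollary 1 — `f₁(η, −1, 1) = 2ι(η)`, `C(𝒵, −1) = Σ 12/(9 + 4γ₊²)`, and, for even `χ`,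
`w_{1,−1} = ½ log(q/(πe^{λ₀})) + (L′/L)(2, χ)`; hence the inequality of Corollary 1 is literally the inequality
of Theorem 7 (i) (`δ = −1`, `m = 1`). [cite: HiaryIrelandKyi2026, §1 (derivation of Corollary 1)] -/
theorem HiaryIrelandKyi2026.corollary1_ineq_iff {q : ℕ} [NeZero q] {χ : DirichletCharacter ℂ q}
    (heven : χ.Even)
    (Z : Finset (ℝ × ℝ)) (η : ℝ) :
    wOne χ (-1) < 2 * min (phi 0 η (-1)) (phi (1 / 2) η (-1)) + C Z (-1) ↔
      1 / 2 * Real.log (q / (Real.pi * Real.exp Real.eulerMascheroniConstant)) +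
          (deriv χ.LFunction 2 / χ.LFunction 2).re <
        2 * iota η + ∑ P ∈ Z, 12 / (9 + 4 * P.2 ^ 2) := by
  rw [wOne_neg_one_of_even heven, two_mul_iota_eq, C_neg_one]

end Literature.NumberTheory.LFunctions
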